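import Summits.CriticalPhenomena.Ising3D.Control2DKernelCell
import HarnessLib

/-!
# Splitting the one-sided sums `uZ Nd c k` into partial `m`-sums (kernel-memory-safe literals)
(cell `pub-ising3x`, seat controls-1 gen 17; KERNEL PATH for the 2D γ-certificates, literal library — CONTROL-ONLY scaffolding)

HONEST FRAMING: lottery ticket; floor = tightest certified 3D Ising CFT bounds; no exact-solution
claim without a proof. Nothing about any CFT is asserted here.

`uZ Nd c k = Σ_{m ≤ Nd} 2^{Nd-m} Â_m(y + c) · Q̃_k(y + c + m)` (`Control2DKernelCell`) is materialised as an integer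
literal by ONE `decide +kernel` in the library files `Control2DUZn*` (controls-1 g16, `k ≤ 11`). At `Nd = 55` and
`k = 12, 13` (needed by the Λ = 13 replays) that single decision trips the kernel's memory guard
(`(kernel) excessive memory consumption detected`, measured 2026-08-22). This file splits the `m`-sum:
`uZTerm` (one term), `uZFrom Nd c k a n = Σ_{a ≤ m < a+n} uZTerm m`, `uZ_eq_uZFrom`, `uZFrom_add`, and the
ready-to-instantiate forms `uZ_split2 / uZ_split3 / uZ_split4` (cut points as numerals, side conditions by `rfl`),
so that a literal is certified as `zadd` of 2–4 separately decided partial sums. Exact list identities (no evaluation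
semantics needed): `zadd` is associative on lists. Mirror: HOME/code/controls/kp4/kmirror.py (`uZFrom`). No facts,
standard axioms only.
-/

namespace Summit.CriticalPhenomena.Ising3D.Control2D

/-- `zadd p [] = p`. [folklore] -/
theorem zadd_nil_right : ∀ p : List ℤ, zadd p [] = p
  | [] => rfl
  | _ :: _ => rfl

/-- `zadd` is associative as an operation on coefficient lists. [folklore] -/
theorem zadd_assoc : ∀ p q r : List ℤ, zadd (zadd p q) r = zadd p (zadd q r)
  | [], q, r => by simp [zadd]
  | a :: p, [], r => by rw [zadd_nil_right]; cases r <;> rfl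
  | a :: p, b :: q, [] => by rw [zadd_nil_right, zadd_nil_right]
  | a :: p, b :: q, c :: r => by
      show (a + b + c) :: zadd (zadd p q) r = (a + (b + c)) :: zadd p (zadd q r)
      rw [zadd_assoc p q r, add_assoc]

/-- The `m`-th term of `uZ Nd c k`: `2^{Nd-m} · Â_m · Q̃_k(· + c + m)`. [folklore] -/
def uZTerm (Nd c k m : ℕ) : List ℤ :=
  zsmul (2 ^ (Nd - m)) (zmul (ahatZ Nd c m) (zshift (qtZ k) ((c + m : ℕ) : ℤ)))

/-- The partial `m`-sum `Σ_{a ≤ m < a + n} uZTerm Nd c k m` (accumulated like `zsumRange`). [folklore] -/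
def uZFrom (Nd c k a : ℕ) : ℕ → List ℤ
  | 0 => []
  | n + 1 => zadd (uZFrom Nd c k a n) (uZTerm Nd c k (a + n))

/-- [folklore] -/
theorem zsumRange_uZTerm (Nd c k : ℕ) : ∀ n : ℕ, zsumRange (uZTerm Nd c k) n = uZFrom Nd c k 0 n
  | 0 => rfl
  | n + 1 => by rw [zsumRange, uZFrom, zsumRange_uZTerm Nd c k n, Nat.zero_add]

/-- **`uZ` is the full partial sum.** [folklore] -/
theorem uZ_eq_uZFrom (Nd c k : ℕ) : uZ Nd c k = uZFrom Nd c k 0 (Nd + 1) :=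
  zsumRange_uZTerm Nd c k (Nd + 1)

/-- **Splitting a partial sum** (exact list identity). [folklore] -/
theorem uZFrom_add (Nd c k a n₁ : ℕ) :
    ∀ n₂ : ℕ, uZFrom Nd c k a (n₁ + n₂) = zadd (uZFrom Nd c k a n₁) (uZFrom Nd c k (a + n₁) n₂)
  | 0 => by rw [Nat.add_zero, uZFrom, zadd_nil_right]
  | n₂ + 1 => by
      rw [Nat.add_succ, uZFrom, uZFrom, uZFrom_add Nd c k a n₁ n₂, zadd_assoc, Nat.add_assoc]

/-- Two parts: `uZ = part[0, n₁) + part[n₁, Nd+1)`. [folklore] -/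
theorem uZ_split2 (Nd c k n₁ n₂ : ℕ) (hN : n₁ + n₂ = Nd + 1) :
    uZ Nd c k = zadd (uZFrom Nd c k 0 n₁) (uZFrom Nd c k n₁ n₂) := by
  rw [uZ_eq_uZFrom, ← hN, uZFrom_add, Nat.zero_add]

/-- Three parts (cut points `b₂ = n₁`, `b₃ = n₁ + n₂` given as numerals). [folklore] -/
theorem uZ_split3 (Nd c k n₁ n₂ n₃ b₃ : ℕ) (h₃ : n₁ + n₂ = b₃) (hN : n₁ + n₂ + n₃ = Nd + 1) :
    uZ Nd c k = zadd (zadd (uZFrom Nd c k 0 n₁) (uZFrom Nd c k n₁ n₂)) (uZFrom Nd c k b₃ n₃) := by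
  rw [uZ_eq_uZFrom, ← hN, uZFrom_add, uZFrom_add, Nat.zero_add, Nat.zero_add, h₃]

/-- Four parts. [folklore] -/
theorem uZ_split4 (Nd c k n₁ n₂ n₃ n₄ b₃ b₄ : ℕ) (h₃ : n₁ + n₂ = b₃) (h₄ : n₁ + n₂ + n₃ = b₄)
    (hN : n₁ + n₂ + n₃ + n₄ = Nd + 1) :
    uZ Nd c k = zadd (zadd (zadd (uZFrom Nd c k 0 n₁) (uZFrom Nd c k n₁ n₂)) (uZFrom Nd c k b₃ n₃))
      (uZFrom Nd c k b₄ n₄) := by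
  rw [uZ_eq_uZFrom, ← hN, uZFrom_add, uZFrom_add, uZFrom_add, Nat.zero_add, Nat.zero_add, Nat.zero_add,
    h₄, h₃]

end Summit.CriticalPhenomena.Ising3D.Control2D
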